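import Literature.MathematicalPhysics.QuantumFieldTheory.ConformalBootstrap3D.BlockExistenceLimitAB
import Literature.MathematicalPhysics.QuantumFieldTheory.ConformalBootstrap3D.MixedBlockResidue
import Literature.MathematicalPhysics.QuantumFieldTheory.ConformalBootstrap3D.PointFunctionalTail
import Mathlib.Analysis.Normed.Group.Tannery
import Mathlib.Analysis.SpecialFunctions.Pow.Continuity
import Mathlib.Tactic
import HarnessLib

/-!
# The genuine pole of the mixed-channel block at the 3D unitarity bound: value-level residue and non-existence

Kos–Poland–Simmons-Duffin 2014 §4 (eqs. (4.2)–(4.3), Table 1): as a function of `Δ` the conformal block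
`g^{Δ₁₂,Δ₃₄}_{Δ,ℓ}` is meromorphic with simple poles, `g_{Δ,ℓ} ~ c_i/(Δ - Δ_i) · g_{Δ_i+n_i,ℓ_i}`; the third
family of their Table 1 at `k = 1`, `d = 3` is the unitarity bound `Δ = ℓ + 1` of a spin-`ℓ ≥ 1` primary,
with null descendant `(Δ', ℓ') = (ℓ+2, ℓ-1)` and residue proportional to `Δ₁₂ Δ₃₄`.
`MixedBlockResidue` proved this at the level of the `z`-series COEFFICIENT arrays of the typed blocks
(`tendsto_sub_mul_hrCoeffAB`). This file proves it at the level of the block FUNCTIONS on the square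
`(0,1)²` and draws the consequence for the typed block predicate `IsConformalBlock3D`:

* `tendsto_sub_mul_hrBlockAB` — for `ℓ ≥ 1` and every `Δ₁₂, Δ₃₄`, pointwise on `(0,1)²`,
  `(Δ - ℓ - 1) · hrBlockAB Δ₁₂ Δ₃₄ Δ ℓ → blockResidueConst Δ₁₂ Δ₃₄ ℓ · hrBlockAB Δ₁₂ Δ₃₄ (ℓ+2) (ℓ-1)` as
  `Δ ↓ ℓ+1`, with `blockResidueConst Δ₁₂ Δ₃₄ ℓ = -Δ₁₂ Δ₃₄ ℓ² / (4ℓ² - 1)` (`blockResidueConst_eq`; the residue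
  constant `hrResidueConst` of the Hogervorst–Rychkov-normalised arrays times `λ_{ℓ-1}/λ_ℓ = 2ℓ/(2ℓ-1)`,
  the change to the typed normalisation `c_ℓ = 1` of `HasLeadingPart`);
* `not_isConformalBlock3D_of_pole` — **for `Δ₁₂ Δ₃₄ ≠ 0` and `ℓ ≥ 1` NO function satisfies
  `IsConformalBlock3D Δ₁₂ Δ₃₄ (ℓ+1) ℓ`**: the limit clause of the predicate would force the blocks
  `g_{Δ',ℓ}`, `Δ' ↓ ℓ+1` (equal to `hrBlockAB` by uniqueness at regular points) to converge, while
  `(Δ' - ℓ - 1) g_{Δ',ℓ}` tends to a non-zero multiple of `g_{ℓ+2,ℓ-1} ≢ 0`;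
* `exists_isConformalBlock3D_iff_ne_bound` — together with `BlockExistenceLimitAB`: for `Δ₁₂ Δ₃₄ ≠ 0`,
  `ℓ ≥ 1`, `Δ₀ ≥ ℓ+1`, the typed predicate has a solution iff `Δ₀ ≠ ℓ+1`. With `BlockExistence`,
  `BlockExistenceLimit`, `BlockExistenceAB`, `BlockExistenceLimitAB` this completes the satisfiability
  picture of the typed clause A2 of the `σ–ε` system in BOTH directions (pub-ising3d paper, Limitation (a));
* `SigmaEpsilonData.bound_lt_Δm_of_satisfiesBootstrapAxioms` — consequently a datum satisfying the typed
  axioms with `Δ_σ ≠ Δ_ε` has every `ℤ₂`-odd exchanged operator of spin `ℓ ≥ 1` STRICTLY above the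
  unitarity bound: clause A2 excludes spin-`ℓ` conserved currents from `σ × ε`, exactly as the Ward identity
  does in a CFT (Kos–Poland–Simmons-Duffin 2014 §4; `SigmaEpsilonSystem` docstring (5)).

The analysis (uniform polynomial growth of the regularised arrays `(Δ-ℓ-1)A_{n,j}(a,b;Δ)` on a right
neighbourhood of the pole, Tannery's theorem, the monomial-level shift identity
`e_{N+2,j}(m+1,n+1) = e_{N,j}(m,n)`, identity theorem for the non-vanishing of the residue block) is ours and
elementary; the coefficient-level residue theorem, the growth mechanism and the uniqueness of the generic
block are the tree's (`MixedBlockResidue`, `BlockExistenceAB`/`BlockExistenceLimitAB`,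
`BlockCoefficientExtraction`). Exact-rational cross-check of the monomial-level identity and of the limit
(470 checks, levels ≤ 6, five `(a,b,ℓ)`): pub-ising3d `pub-ising3d-lit-g7/code/check_value_residue.py`.
No hypothesis-style fact is introduced.

References: F. Kos, D. Poland, D. Simmons-Duffin, JHEP 11 (2014) 109 [arXiv:1406.4858], §4 eqs. (4.2)–(4.3),
Table 1 [cite: KosPolandSimmonsduffin2014, §4 eqs. (4.2)–(4.3)]; F. A. Dolan, H. Osborn, Nucl. Phys. B 678
(2004) 491, §3 eqs. (3.9)–(3.13) [cite: DolanOsborn2004, §3 eqs. (3.11)–(3.12)]; M. Hogervorst, H. Osborn,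
S. Rychkov, JHEP 08 (2013) 014, App. A [cite: HogervorstOsbornRychkov2013, App. A]. Mathlib:
`tendsto_tsum_of_dominated_convergence`, `tendsto_nhds_unique`.
-/

namespace Literature.MathematicalPhysics.QuantumFieldTheory.ConformalBootstrap3D

open Finset Set Filter Topology

/-! ### 0. Small helpers -/

/-- `𝓝[>] x ≤ 𝓝[≠] x`. [folklore] -/
private theorem nhdsGT_le_nhdsNE' (x : ℝ) : 𝓝[>] x ≤ 𝓝[≠] x :=
  nhdsWithin_mono _ fun _ hy => ne_of_gt hy

/-- For `ℓ ≥ 1` the 3D unitarity bound of spin `ℓ` is `ℓ + 1`. [cite: HogervorstRychkov2013, §2] -/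
private theorem unitarityBound3D_eq_of_one_le {ℓ : ℕ} (hℓ : 1 ≤ ℓ) :
    unitarityBound3D ℓ = (ℓ : ℝ) + 1 := by
  unfold unitarityBound3D; rw [if_neg (by omega)]

/-- The unitarity bound of spin `ℓ - 1` lies below `ℓ + 2`. [folklore] -/
private theorem unitarityBound3D_pred_lt (ℓ : ℕ) : unitarityBound3D (ℓ - 1) < (ℓ : ℝ) + 2 := by
  have hℓ0 : (0 : ℝ) ≤ ℓ := Nat.cast_nonneg ℓ
  unfold unitarityBound3D
  split_ifs with h0
  · linarith
  · have h1 : 1 ≤ ℓ := by omega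
    have : ((ℓ - 1 : ℕ) : ℝ) = (ℓ : ℝ) - 1 := by rw [Nat.cast_sub h1, Nat.cast_one]
    rw [this]; linarith

/-! ### 1. The Legendre monomial arrays under the shift `(m, n) ↦ (m+1, n+1)` -/

/-- **Shift identity** `e_{N+2,j}(m+1,n+1) = e_{N,j}(m,n)` for `j ≤ N`: multiplying the degree-`N` spin-`j`
Legendre monomial array by `z z̄` gives the degree-`(N+2)` one (`𝒫_{E+1,j} = (z z̄)^{1/2} 𝒫_{E,j}`).
[cite: HogervorstRychkov2013, §3 eq. (3.6)] -/
theorem legendreArrDeg_add_two_succ_succ {N j : ℕ} (hj : j ≤ N) (m n : ℕ) :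
    legendreArrDeg (N + 2) j (m + 1, n + 1) = legendreArrDeg N j (m, n) := by
  unfold legendreArrDeg
  by_cases hpar : (N + j) % 2 = 0
  · have hpar' : (N + 2 + j) % 2 = 0 := by omega
    rw [if_pos ⟨by omega, hpar'⟩, if_pos ⟨hj, hpar⟩]
    have ht : (N + 2 - j) / 2 = (N - j) / 2 + 1 := by omega
    rw [ht]
    unfold legendreArr
    simp only
    by_cases hc : (N - j) / 2 ≤ m ∧ (N - j) / 2 ≤ n ∧ m + n = 2 * ((N - j) / 2) + j
    · rw [if_pos (by omega), if_pos hc]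
      have e1 : m + 1 - ((N - j) / 2 + 1) = m - (N - j) / 2 := by omega
      have e2 : n + 1 - ((N - j) / 2 + 1) = n - (N - j) / 2 := by omega
      rw [e1, e2]
    · rw [if_neg (by omega), if_neg hc]
  · rw [if_neg (fun h => hpar (by omega)), if_neg (fun h => hpar h.2)]
    rfl

/-- On the column `n = 0` only the top spin survives: `e_{N,j}(m,0) = 0` for `j ≠ N`. [folklore] -/
theorem legendreArrDeg_snd_zero_of_ne {N j : ℕ} (hj : j ≠ N) (m : ℕ) :
    legendreArrDeg N j (m, 0) = 0 := by
  unfold legendreArrDeg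
  split_ifs with h1
  · unfold legendreArr
    split_ifs with h2
    · exfalso
      simp only at h2
      omega
    · rfl
  · rfl

/-- On the row `m = 0` only the top spin survives: `e_{N,j}(0,n) = 0` for `j ≠ N`. [folklore] -/
theorem legendreArrDeg_fst_zero_of_ne {N j : ℕ} (hj : j ≠ N) (n : ℕ) :
    legendreArrDeg N j (0, n) = 0 := by
  unfold legendreArrDeg
  split_ifs with h1
  · unfold legendreArr
    split_ifs with h2
    · exfalso
      simp only at h2
      omega
    · rfl
  · rfl

/-! ### 2. The residue of the monomial coefficients -/

section Coefficients

variable (a b : ℝ)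

/-- The limit array of `(Δ - ℓ - 1) · k^{ab}_{mn}(Δ, ℓ)` at `Δ = ℓ + 1`: on degree `N = m + n ≥ ℓ + 1` the
Legendre resummation of the residue array `hrResidueConst · A_{N-ℓ-1,·}(a,b;ℓ+2,ℓ-1)` (still divided by the
spin-`ℓ` normalisation `λ_ℓ`), and `0` in degrees `≤ ℓ`. [cite: KosPolandSimmonsduffin2014, §4 eqs. (4.2)–(4.3)] -/
noncomputable def resCoeffAB (ℓ : ℕ) (p : ℕ × ℕ) : ℝ :=
  if ℓ + 1 ≤ p.1 + p.2 then
    ∑ j ∈ range (p.1 + p.2 + 1),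
      (hrResidueConst a b ℓ * hrCoeffAB a b ((ℓ : ℝ) + 2) (ℓ - 1) (p.1 + p.2 - ℓ - 1) j / legendreLam ℓ) *
        legendreArrDeg (p.1 + p.2) j p
  else 0

/-- **Termwise residue**: `(Δ - ℓ - 1) k^{ab}_p(Δ,ℓ) → resCoeffAB a b ℓ p` as `Δ → ℓ+1`, `Δ ≠ ℓ+1`
(`ℓ ≥ 1`), from the coefficient-level residue theorem `tendsto_sub_mul_hrCoeffAB`.
[cite: KosPolandSimmonsduffin2014, §4 eqs. (4.2)–(4.3)] -/
theorem tendsto_sub_mul_hrMonomialCoeffAB {ℓ : ℕ} (hℓ : 1 ≤ ℓ) (p : ℕ × ℕ) :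
    Tendsto (fun Δ : ℝ => (Δ - ℓ - 1) * hrMonomialCoeffAB a b Δ ℓ p) (𝓝[≠] ((ℓ : ℝ) + 1))
      (𝓝 (resCoeffAB a b ℓ p)) := by
  rcases lt_or_ge (p.1 + p.2) ℓ with hlt | hge
  · -- below degree `ℓ` everything vanishes
    have h0 : (fun Δ : ℝ => (Δ - ℓ - 1) * hrMonomialCoeffAB a b Δ ℓ p) = fun _ => 0 := by
      funext Δ
      rw [hrMonomialCoeffAB_eq_zero_of_lt a b Δ ℓ hlt, mul_zero]
    have hres : resCoeffAB a b ℓ p = 0 := by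
      unfold resCoeffAB; rw [if_neg (by omega)]
    rw [h0, hres]
    exact tendsto_const_nhds
  · have hfun : (fun Δ : ℝ => (Δ - ℓ - 1) * hrMonomialCoeffAB a b Δ ℓ p) = fun Δ : ℝ =>
        ∑ j ∈ range (p.1 + p.2 + 1),
          ((Δ - ℓ - 1) * hrCoeffAB a b Δ ℓ (p.1 + p.2 - ℓ) j / legendreLam ℓ) *
            legendreArrDeg (p.1 + p.2) j p := by
      funext Δ
      rw [hrMonomialCoeffAB_eq_slice a b Δ ℓ rfl hge]
      unfold hrSliceAB
      rw [Finset.mul_sum]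
      exact Finset.sum_congr rfl fun j _ => by ring
    rw [hfun]
    rcases eq_or_lt_of_le hge with heq | hgt
    · -- degree `ℓ`: level `0`, no pole
      have hres : resCoeffAB a b ℓ p = 0 := by
        unfold resCoeffAB; rw [if_neg (by omega)]
      rw [hres]
      have hlev : p.1 + p.2 - ℓ = 0 := by omega
      rw [hlev]
      have h := tendsto_finsetSum (range (p.1 + p.2 + 1)) fun j _ =>
        ((tendsto_sub_mul_hrCoeffAB_zero a b ℓ j).div_const (legendreLam ℓ)).mul_const
          (legendreArrDeg (p.1 + p.2) j p)
      simpa using h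
    · -- degree `≥ ℓ + 1`: the residue theorem at level `p.1 + p.2 - ℓ ≥ 1`
      have hN : 1 ≤ p.1 + p.2 - ℓ := by omega
      have hres : resCoeffAB a b ℓ p = ∑ j ∈ range (p.1 + p.2 + 1),
          (hrResidueConst a b ℓ * hrCoeffAB a b ((ℓ : ℝ) + 2) (ℓ - 1) (p.1 + p.2 - ℓ - 1) j /
              legendreLam ℓ) * legendreArrDeg (p.1 + p.2) j p := by
        unfold resCoeffAB; rw [if_pos (by omega)]
      rw [hres]
      exact tendsto_finsetSum _ fun j _ =>
        ((tendsto_sub_mul_hrCoeffAB_of_pos a b hℓ hN j).div_const _).mul_const _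

/-- **The limit array is the shifted residue block's array**: `resCoeffAB a b ℓ (m+1, n+1) =
hrResidueConst a b ℓ · (λ_{ℓ-1}/λ_ℓ) · k^{ab}_{mn}(ℓ+2, ℓ-1)` and `resCoeffAB a b ℓ (m, 0) =
resCoeffAB a b ℓ (0, n) = 0` — multiplication of the double series by `z z̄` and the change from the
spin-`ℓ` normalisation `λ_ℓ` to the spin-`(ℓ-1)` normalisation `λ_{ℓ-1}` (`HasLeadingPart`, `c_ℓ = 1`).
[cite: KosPolandSimmonsduffin2014, §4 eqs. (4.2)–(4.3)] -/
theorem resCoeffAB_eq {ℓ : ℕ} (hℓ : 1 ≤ ℓ) (p : ℕ × ℕ) :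
    resCoeffAB a b ℓ p = hrResidueConst a b ℓ * (legendreLam (ℓ - 1) / legendreLam ℓ) *
      (if 1 ≤ p.1 ∧ 1 ≤ p.2 then hrMonomialCoeffAB a b ((ℓ : ℝ) + 2) (ℓ - 1) (p.1 - 1, p.2 - 1)
        else 0) := by
  obtain ⟨m, n⟩ := p
  simp only
  have hlam := legendreLam_ne_zero ℓ
  have hlam' := legendreLam_ne_zero (ℓ - 1)
  -- the residue array vanishes for spins above the shifted range
  have hAtop : ∀ {N j : ℕ}, ℓ + 1 ≤ N → N - 1 ≤ j →
      hrCoeffAB a b ((ℓ : ℝ) + 2) (ℓ - 1) (N - ℓ - 1) j = 0 := fun {N j} hN hj =>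
    hrCoeffAB_eq_zero_of_not_inDescendantRange a b _ (fun ⟨_, h2, _⟩ => by omega)
  rcases lt_or_ge (m + n) (ℓ + 1) with hlt | hge
  · -- low degree: both sides vanish
    have hL : resCoeffAB a b ℓ (m, n) = 0 := by
      unfold resCoeffAB; rw [if_neg (by simpa using hlt)]
    rw [hL]
    split_ifs with hmn
    · rw [hrMonomialCoeffAB_eq_zero_of_lt a b _ _ (by simp only; omega), mul_zero]
    · rw [mul_zero]
  · have hL : resCoeffAB a b ℓ (m, n) = ∑ j ∈ range (m + n + 1),
        (hrResidueConst a b ℓ * hrCoeffAB a b ((ℓ : ℝ) + 2) (ℓ - 1) (m + n - ℓ - 1) j /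
            legendreLam ℓ) * legendreArrDeg (m + n) j (m, n) := by
      unfold resCoeffAB; rw [if_pos (by simpa using hge)]
    rw [hL]
    split_ifs with hmn
    · -- interior point: shift identity
      obtain ⟨m', rfl⟩ : ∃ m', m = m' + 1 := ⟨m - 1, by omega⟩
      obtain ⟨n', rfl⟩ : ∃ n', n = n' + 1 := ⟨n - 1, by omega⟩
      simp only [Nat.add_sub_cancel]
      have hdeg : ℓ - 1 ≤ m' + n' := by omega
      rw [hrMonomialCoeffAB_eq_slice a b _ (ℓ - 1) (N := m' + n') rfl hdeg]
      unfold hrSliceAB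
      have hsum : m' + 1 + (n' + 1) = m' + n' + 2 := by ring
      have hlev : m' + 1 + (n' + 1) - ℓ - 1 = m' + n' - (ℓ - 1) := by omega
      rw [hlev, hsum, Finset.sum_range_succ, Finset.sum_range_succ]
      have htop1 : hrCoeffAB a b ((ℓ : ℝ) + 2) (ℓ - 1) (m' + n' - (ℓ - 1)) (m' + n' + 1) = 0 :=
        hrCoeffAB_eq_zero_of_not_inDescendantRange a b _ (fun ⟨_, h2, _⟩ => by omega)
      have htop2 : hrCoeffAB a b ((ℓ : ℝ) + 2) (ℓ - 1) (m' + n' - (ℓ - 1)) (m' + n' + 2) = 0 :=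
        hrCoeffAB_eq_zero_of_not_inDescendantRange a b _ (fun ⟨_, h2, _⟩ => by omega)
      rw [htop1, htop2, mul_zero, zero_div, zero_mul, add_zero, zero_mul, add_zero, Finset.mul_sum]
      refine Finset.sum_congr rfl fun j hj => ?_
      have hjN : j ≤ m' + n' := by
        have := mem_range.mp hj; omega
      rw [legendreArrDeg_add_two_succ_succ hjN]
      field_simp
    · -- boundary point `m = 0` or `n = 0`: every term vanishes
      refine (Finset.sum_eq_zero fun j hj => ?_).trans (mul_zero _).symm
      have hjle : j ≤ m + n := by have := mem_range.mp hj; omega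
      rcases eq_or_lt_of_le hjle with hjeq | hjlt
      · rw [hAtop hge (by omega), mul_zero, zero_div, zero_mul]
      · have hmn' : m = 0 ∨ n = 0 := by omega
        rcases hmn' with hm | hn
        · subst hm
          rw [legendreArrDeg_fst_zero_of_ne (by omega), mul_zero]
        · subst hn
          rw [legendreArrDeg_snd_zero_of_ne (by omega), mul_zero]

end Coefficients

/-! ### 3. Uniform polynomial growth of the regularised array near the pole -/

/-- **Uniform growth on a right neighbourhood of the pole**: for `ℓ ≥ 1` there are `K`, `M ≥ 0` with
`(Δ - ℓ - 1) · Σ_j |A_{n,j}(a,b;Δ,ℓ)| ≤ M q_K(n)` for every `n` and all `Δ > ℓ+1` close to `ℓ+1`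
(the growth step of `BlockExistenceAB` beyond the common threshold `⌈(ℓ+2+2c+1+ℓ+2)²⌉`, and the
finitely many regularised head levels, which have limits at the pole). [cite: DolanOsborn2004, §3 eqs. (3.9)–(3.12)] -/
theorem exists_eventually_sub_mul_absLevelSumAB_le (a b : ℝ) {ℓ : ℕ} (hℓ : 1 ≤ ℓ) :
    ∃ (K : ℕ) (M : ℝ), 0 ≤ M ∧ ∀ᶠ Δ in 𝓝[>] ((ℓ : ℝ) + 1), ∀ n : ℕ,
      (Δ - ℓ - 1) * hrAbsLevelSumAB a b Δ ℓ n ≤ M * ascWeight K n := by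
  have hb : unitarityBound3D ℓ = (ℓ : ℝ) + 1 := unitarityBound3D_eq_of_one_le hℓ
  have hle := nhdsGT_le_nhdsNE' ((ℓ : ℝ) + 1)
  have hℓ0 : (0 : ℝ) ≤ ℓ := Nat.cast_nonneg ℓ
  set c := max |a| |b| with hc
  have ha : |a| ≤ c := le_max_left _ _
  have hb' : |b| ≤ c := le_max_right _ _
  have hc0 : 0 ≤ c := (abs_nonneg a).trans ha
  set κ := ⌈c⌉₊ with hκ
  set K : ℕ := 40 * κ + 24 with hK
  have hKc : 40 * c + 24 ≤ (K : ℝ) := by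
    have : c ≤ (κ : ℝ) := Nat.le_ceil c
    rw [hK]; push_cast; linarith
  set N₁ := ⌈abThreshold c ((ℓ : ℝ) + 2) ℓ⌉₊ with hN₁
  -- every regularised level is eventually bounded near the pole
  have hlim : ∀ k : ℕ, ∃ L : ℝ, ∀ᶠ Δ in 𝓝[>] ((ℓ : ℝ) + 1),
      (Δ - ℓ - 1) * hrAbsLevelSumAB a b Δ ℓ k ≤ L := by
    intro k
    have hT : ∀ j : ℕ, ∃ Lj : ℝ, Tendsto (fun Δ : ℝ => |(Δ - ℓ - 1) * hrCoeffAB a b Δ ℓ k j|)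
        (𝓝[>] ((ℓ : ℝ) + 1)) (𝓝 Lj) := by
      intro j
      rcases Nat.eq_zero_or_pos k with hk | hk
      · subst hk
        exact ⟨_, ((tendsto_sub_mul_hrCoeffAB_zero a b ℓ j).mono_left hle).abs⟩
      · exact ⟨_, ((tendsto_sub_mul_hrCoeffAB_of_pos a b hℓ hk j).mono_left hle).abs⟩
    choose Lj hLj using hT
    refine ⟨∑ j ∈ range (ℓ + k + 1), Lj j + 1, ?_⟩
    have hsum : Tendsto (fun Δ : ℝ => ∑ j ∈ range (ℓ + k + 1), |(Δ - ℓ - 1) * hrCoeffAB a b Δ ℓ k j|)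
        (𝓝[>] ((ℓ : ℝ) + 1)) (𝓝 (∑ j ∈ range (ℓ + k + 1), Lj j)) :=
      tendsto_finsetSum _ fun j _ => hLj j
    have hev := hsum.eventually (gt_mem_nhds (lt_add_one _))
    filter_upwards [hev, self_mem_nhdsWithin] with Δ hΔ hpos
    have hpos' : 0 < Δ - ℓ - 1 := by
      have : (ℓ : ℝ) + 1 < Δ := hpos
      linarith
    have heq : (Δ - ℓ - 1) * hrAbsLevelSumAB a b Δ ℓ k =
        ∑ j ∈ range (ℓ + k + 1), |(Δ - ℓ - 1) * hrCoeffAB a b Δ ℓ k j| := by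
      unfold hrAbsLevelSumAB
      rw [Finset.mul_sum]
      refine Finset.sum_congr rfl fun j _ => ?_
      rw [abs_mul, abs_of_pos hpos']
    rw [heq]; exact hΔ.le
  choose L hL using hlim
  set M : ℝ := ∑ k ∈ range (N₁ + 1), max (L k) 0 with hM
  have hM0 : 0 ≤ M := Finset.sum_nonneg fun k _ => le_max_right _ _
  have hLM : ∀ k, k ≤ N₁ → L k ≤ M := fun k hk =>
    (le_max_left (L k) 0).trans (Finset.single_le_sum (f := fun k => max (L k) 0)
      (fun k _ => le_max_right _ _) (mem_range.mpr (Nat.lt_succ_of_le hk)))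
  refine ⟨K, M, hM0, ?_⟩
  have hall : ∀ᶠ Δ in 𝓝[>] ((ℓ : ℝ) + 1), ∀ k ∈ range (N₁ + 1),
      (Δ - ℓ - 1) * hrAbsLevelSumAB a b Δ ℓ k ≤ L k :=
    (eventually_all_finset _).mpr fun k _ => hL k
  have hIoc : Ioc ((ℓ : ℝ) + 1) ((ℓ : ℝ) + 2) ∈ 𝓝[>] ((ℓ : ℝ) + 1) := Ioc_mem_nhdsGT (by linarith)
  filter_upwards [hall, hIoc] with Δ hΔ hmem n
  have hpos : 0 < Δ - ℓ - 1 := by linarith [hmem.1]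
  have hne : Δ - ℓ - 1 ≠ 0 := hpos.ne'
  have hΔ' : unitarityBound3D ℓ < Δ := by rw [hb]; exact hmem.1
  have hthr : abThreshold c Δ ℓ ≤ N₁ := by
    have hmono : abThreshold c Δ ℓ ≤ abThreshold c ((ℓ : ℝ) + 2) ℓ := by
      unfold abThreshold hrThreshold
      have h0 : 0 ≤ Δ + (2 * c + 1) + ℓ + 2 := by linarith [hmem.1]
      have h1 : Δ + (2 * c + 1) + ℓ + 2 ≤ (ℓ : ℝ) + 2 + (2 * c + 1) + ℓ + 2 := by linarith [hmem.2]
      exact pow_le_pow_left₀ h0 h1 2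
    exact hmono.trans (Nat.le_ceil _)
  have hhead : ∀ k : ℕ, k ≤ N₁ → hrAbsLevelSumAB a b Δ ℓ k ≤ M / (Δ - ℓ - 1) := by
    intro k hk
    rw [le_div_iff₀ hpos, mul_comm]
    exact (hΔ k (mem_range.mpr (Nat.lt_succ_of_le hk))).trans (hLM k hk)
  have h := hrAbsLevelSumAB_le_of_bound hΔ' ha hb' hthr hKc (div_nonneg hM0 hpos.le) hhead n
  calc (Δ - ℓ - 1) * hrAbsLevelSumAB a b Δ ℓ n
      ≤ (Δ - ℓ - 1) * (M / (Δ - ℓ - 1) * ascWeight K n) := mul_le_mul_of_nonneg_left h hpos.le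
    _ = M * ascWeight K n := by field_simp

/-! ### 4. The value-level residue theorem -/

/-- **Tannery at the pole, series level**: for `ℓ ≥ 1` and `|z|, |z̄| < 1`,
`(Δ - ℓ - 1) · K^{ab}_{Δ,ℓ}(z,z̄) → Σ_p resCoeffAB a b ℓ p z^{p₁} z̄^{p₂}` as `Δ ↓ ℓ+1`.
[cite: KosPolandSimmonsduffin2014, §4 eqs. (4.2)–(4.3)] -/
theorem tendsto_sub_mul_hrSeriesAB (a b : ℝ) {ℓ : ℕ} (hℓ : 1 ≤ ℓ) {z zb : ℝ} (hz : |z| < 1)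
    (hzb : |zb| < 1) :
    Tendsto (fun Δ : ℝ => (Δ - ℓ - 1) * hrSeriesAB a b Δ ℓ z zb) (𝓝[>] ((ℓ : ℝ) + 1))
      (𝓝 (∑' p : ℕ × ℕ, resCoeffAB a b ℓ p * z ^ p.1 * zb ^ p.2)) := by
  have hle := nhdsGT_le_nhdsNE' ((ℓ : ℝ) + 1)
  obtain ⟨K, M, hM0, hM⟩ := exists_eventually_sub_mul_absLevelSumAB_le a b hℓ
  set t := max |z| |zb| with ht
  have ht0 : 0 ≤ t := le_max_of_le_left (abs_nonneg z)
  have ht1 : t < 1 := max_lt hz hzb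
  have hlam := legendreLam_pos ℓ
  set bound : ℕ × ℕ → ℝ := fun p =>
    M / legendreLam ℓ * ((ascWeight K p.1 * t ^ p.1) * (ascWeight K p.2 * t ^ p.2)) with hbound
  have hg := summable_ascWeight_mul_pow K ht0 ht1
  have hsum : Summable bound :=
    (hg.mul_of_nonneg hg (fun m => mul_nonneg (ascWeight_pos K m).le (pow_nonneg ht0 _))
      (fun m => mul_nonneg (ascWeight_pos K m).le (pow_nonneg ht0 _))).mul_left _
  have hfun : (fun Δ : ℝ => (Δ - ℓ - 1) * hrSeriesAB a b Δ ℓ z zb) = fun Δ : ℝ =>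
      ∑' p : ℕ × ℕ, ((Δ - ℓ - 1) * hrMonomialCoeffAB a b Δ ℓ p) * z ^ p.1 * zb ^ p.2 := by
    funext Δ
    unfold hrSeriesAB
    rw [← tsum_mul_left]
    exact tsum_congr fun p => by ring
  rw [hfun]
  refine tendsto_tsum_of_dominated_convergence hsum (fun p => ?_) ?_
  · exact (((tendsto_sub_mul_hrMonomialCoeffAB a b hℓ p).mono_left hle).mul_const _).mul_const _
  · filter_upwards [hM, self_mem_nhdsWithin] with Δ hΔ hgt p
    have hpos : 0 < Δ - ℓ - 1 := by
      have : (ℓ : ℝ) + 1 < Δ := hgt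
      linarith
    have hk : |(Δ - ℓ - 1) * hrMonomialCoeffAB a b Δ ℓ p| ≤
        M / legendreLam ℓ * (ascWeight K p.1 * ascWeight K p.2) := by
      rcases Nat.lt_or_ge (p.1 + p.2) ℓ with hN | hN
      · rw [hrMonomialCoeffAB_eq_zero_of_lt a b Δ ℓ hN, mul_zero, abs_zero]
        exact mul_nonneg (div_nonneg hM0 hlam.le)
          (mul_nonneg (ascWeight_pos _ _).le (ascWeight_pos _ _).le)
      · rw [abs_mul, abs_of_pos hpos]
        refine (mul_le_mul_of_nonneg_left (abs_hrMonomialCoeffAB_le a b Δ ℓ p hN) hpos.le).trans ?_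
        have hle1 : (Δ - ℓ - 1) * hrAbsLevelSumAB a b Δ ℓ (p.1 + p.2 - ℓ) ≤
            M * (ascWeight K p.1 * ascWeight K p.2) :=
          calc (Δ - ℓ - 1) * hrAbsLevelSumAB a b Δ ℓ (p.1 + p.2 - ℓ)
              ≤ M * ascWeight K (p.1 + p.2 - ℓ) := hΔ _
            _ ≤ M * ascWeight K (p.1 + p.2) :=
                mul_le_mul_of_nonneg_left (ascWeight_mono K (by omega)) hM0
            _ ≤ M * (ascWeight K p.1 * ascWeight K p.2) :=
                mul_le_mul_of_nonneg_left (ascWeight_add_le K _ _) hM0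
        calc (Δ - ℓ - 1) * (hrAbsLevelSumAB a b Δ ℓ (p.1 + p.2 - ℓ) / legendreLam ℓ)
            = (Δ - ℓ - 1) * hrAbsLevelSumAB a b Δ ℓ (p.1 + p.2 - ℓ) / legendreLam ℓ := by ring
          _ ≤ M * (ascWeight K p.1 * ascWeight K p.2) / legendreLam ℓ :=
              div_le_div_of_nonneg_right hle1 hlam.le
          _ = M / legendreLam ℓ * (ascWeight K p.1 * ascWeight K p.2) := by ring
    have hq : 0 ≤ M / legendreLam ℓ * (ascWeight K p.1 * ascWeight K p.2) :=
      mul_nonneg (div_nonneg hM0 hlam.le) (mul_nonneg (ascWeight_pos _ _).le (ascWeight_pos _ _).le)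
    have hzp : |z| ^ p.1 ≤ t ^ p.1 := pow_le_pow_left₀ (abs_nonneg z) (le_max_left _ _) _
    have hzbp : |zb| ^ p.2 ≤ t ^ p.2 := pow_le_pow_left₀ (abs_nonneg zb) (le_max_right _ _) _
    rw [Real.norm_eq_abs, abs_mul, abs_mul, abs_pow, abs_pow]
    calc |(Δ - ℓ - 1) * hrMonomialCoeffAB a b Δ ℓ p| * |z| ^ p.1 * |zb| ^ p.2
        ≤ (M / legendreLam ℓ * (ascWeight K p.1 * ascWeight K p.2)) * t ^ p.1 * t ^ p.2 :=
          mul_le_mul (mul_le_mul hk hzp (pow_nonneg (abs_nonneg _) _) hq) hzbp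
            (pow_nonneg (abs_nonneg _) _) (mul_nonneg hq (pow_nonneg ht0 _))
      _ = bound p := by rw [hbound]; ring

/-- **The limit series is the shifted residue block's series**:
`Σ_p resCoeffAB a b ℓ p z^{p₁} z̄^{p₂} = hrResidueConst a b ℓ · (λ_{ℓ-1}/λ_ℓ) · z z̄ · K^{ab}_{ℓ+2,ℓ-1}(z,z̄)`
on the unit bidisk. [cite: KosPolandSimmonsduffin2014, §4 eqs. (4.2)–(4.3)] -/
theorem hasSum_resCoeffAB (a b : ℝ) {ℓ : ℕ} (hℓ : 1 ≤ ℓ) {z zb : ℝ} (hz : |z| < 1) (hzb : |zb| < 1) :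
    HasSum (fun p : ℕ × ℕ => resCoeffAB a b ℓ p * z ^ p.1 * zb ^ p.2)
      (hrResidueConst a b ℓ * (legendreLam (ℓ - 1) / legendreLam ℓ) * (z * zb) *
        hrSeriesAB a b ((ℓ : ℝ) + 2) (ℓ - 1) z zb) := by
  have hS := isDoublePowerSeriesOn_hrSeriesAB (a := a) (b := b) (unitarityBound3D_pred_lt ℓ)
  have hsum : Summable fun p : ℕ × ℕ =>
      hrMonomialCoeffAB a b ((ℓ : ℝ) + 2) (ℓ - 1) p * z ^ p.1 * zb ^ p.2 := by
    refine (hS z zb hz hzb).1.of_norm_bounded fun p => ?_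
    rw [Real.norm_eq_abs, abs_mul, abs_mul, abs_pow, abs_pow]
  have h0 : HasSum (fun p : ℕ × ℕ => hrMonomialCoeffAB a b ((ℓ : ℝ) + 2) (ℓ - 1) p * z ^ p.1 * zb ^ p.2)
      (hrSeriesAB a b ((ℓ : ℝ) + 2) (ℓ - 1) z zb) := hsum.hasSum
  -- multiply by `C z z̄` and shift the indices by `(1,1)`
  have h1 : HasSum (fun p : ℕ × ℕ =>
      hrResidueConst a b ℓ * (legendreLam (ℓ - 1) / legendreLam ℓ) *
        hrMonomialCoeffAB a b ((ℓ : ℝ) + 2) (ℓ - 1) (p.1 + 1 - 1, p.2 + 1 - 1) *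
          z ^ (p.1 + 1) * zb ^ (p.2 + 1))
      (hrResidueConst a b ℓ * (legendreLam (ℓ - 1) / legendreLam ℓ) * (z * zb) *
        hrSeriesAB a b ((ℓ : ℝ) + 2) (ℓ - 1) z zb) := by
    have hfun : (fun p : ℕ × ℕ =>
        hrResidueConst a b ℓ * (legendreLam (ℓ - 1) / legendreLam ℓ) *
          hrMonomialCoeffAB a b ((ℓ : ℝ) + 2) (ℓ - 1) (p.1 + 1 - 1, p.2 + 1 - 1) *
            z ^ (p.1 + 1) * zb ^ (p.2 + 1)) = fun p : ℕ × ℕ =>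
        hrResidueConst a b ℓ * (legendreLam (ℓ - 1) / legendreLam ℓ) * (z * zb) *
          (hrMonomialCoeffAB a b ((ℓ : ℝ) + 2) (ℓ - 1) p * z ^ p.1 * zb ^ p.2) := by
      funext p
      simp only [Nat.add_sub_cancel, pow_succ]
      ring
    rw [hfun]
    exact h0.mul_left _
  have h2 := hasSum_shift11 (G := fun q : ℕ × ℕ =>
    hrResidueConst a b ℓ * (legendreLam (ℓ - 1) / legendreLam ℓ) *
      hrMonomialCoeffAB a b ((ℓ : ℝ) + 2) (ℓ - 1) (q.1 - 1, q.2 - 1) * z ^ q.1 * zb ^ q.2) h1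
  have hfun2 : (fun p : ℕ × ℕ => resCoeffAB a b ℓ p * z ^ p.1 * zb ^ p.2) = fun q : ℕ × ℕ =>
      if 1 ≤ q.1 ∧ 1 ≤ q.2 then
        hrResidueConst a b ℓ * (legendreLam (ℓ - 1) / legendreLam ℓ) *
          hrMonomialCoeffAB a b ((ℓ : ℝ) + 2) (ℓ - 1) (q.1 - 1, q.2 - 1) * z ^ q.1 * zb ^ q.2
      else 0 := by
    funext q
    rw [resCoeffAB_eq a b hℓ q]
    split_ifs <;> ring
  rw [hfun2]
  exact h2

/-- **The residue constant of the typed block** `g^{Δ₁₂,Δ₃₄}_{Δ,ℓ}` (normalisation `c_ℓ = 1`,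
`HasLeadingPart`) at the pole `Δ = ℓ + 1`, relative to the typed block `g^{Δ₁₂,Δ₃₄}_{ℓ+2,ℓ-1}`:
`hrResidueConst(-Δ₁₂/2, Δ₃₄/2, ℓ) · λ_{ℓ-1}/λ_ℓ` (Kos–Poland–Simmons-Duffin 2014 Table 1, family 3,
`k = 1`, at `d = 3`, in the typed normalisation; closed form `blockResidueConst_eq`).
[cite: KosPolandSimmonsduffin2014, §4 Table 1] -/
noncomputable def blockResidueConst (Δ₁₂ Δ₃₄ : ℝ) (ℓ : ℕ) : ℝ :=
  hrResidueConst (-Δ₁₂ / 2) (Δ₃₄ / 2) ℓ * (legendreLam (ℓ - 1) / legendreLam ℓ)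

/-- Closed form: `blockResidueConst Δ₁₂ Δ₃₄ ℓ = -Δ₁₂ Δ₃₄ ℓ² / (4ℓ² - 1)` for `ℓ ≥ 1`
(`λ_{ℓ-1}/λ_ℓ = 2ℓ/(2ℓ-1)`). [cite: KosPolandSimmonsduffin2014, §4 Table 1] -/
theorem blockResidueConst_eq {Δ₁₂ Δ₃₄ : ℝ} {ℓ : ℕ} (hℓ : 1 ≤ ℓ) :
    blockResidueConst Δ₁₂ Δ₃₄ ℓ = -(Δ₁₂ * Δ₃₄) * (ℓ : ℝ) ^ 2 / (4 * (ℓ : ℝ) ^ 2 - 1) := by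
  obtain ⟨i, rfl⟩ : ∃ i, ℓ = i + 1 := ⟨ℓ - 1, by omega⟩
  unfold blockResidueConst hrResidueConst
  simp only [Nat.add_sub_cancel]
  have hrec := legendreLam_succ_mul i
  have hli1 : legendreLam (i + 1) ≠ 0 := legendreLam_ne_zero (i + 1)
  have hi0 : (0 : ℝ) ≤ i := Nat.cast_nonneg i
  have h21 : (2 : ℝ) * (i : ℝ) + 1 ≠ 0 := by positivity
  -- `λ_i / λ_{i+1} = (2i+2)/(2i+1)`
  have hq : legendreLam i / legendreLam (i + 1) = (2 * (i : ℝ) + 2) / (2 * (i : ℝ) + 1) := by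
    rw [div_eq_div_iff hli1 h21]
    linear_combination -hrec
  rw [hq]
  push_cast
  have hd1 : (2 : ℝ) * (2 * ((i : ℝ) + 1) + 1) * (2 * (i : ℝ) + 1) ≠ 0 := by positivity
  have hd2 : 4 * ((i : ℝ) + 1) ^ 2 - 1 ≠ 0 := by nlinarith
  rw [div_mul_div_comm, div_eq_div_iff hd1 hd2]
  ring

/-- The residue constant is non-zero exactly when `Δ₁₂ Δ₃₄ ≠ 0` (`ℓ ≥ 1`). [cite: KosPolandSimmonsduffin2014, §4 Table 1] -/
theorem blockResidueConst_ne_zero {Δ₁₂ Δ₃₄ : ℝ} (h12 : Δ₁₂ * Δ₃₄ ≠ 0) {ℓ : ℕ} (hℓ : 1 ≤ ℓ) :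
    blockResidueConst Δ₁₂ Δ₃₄ ℓ ≠ 0 := by
  rw [blockResidueConst_eq hℓ]
  have hℓ1 : (1 : ℝ) ≤ ℓ := by exact_mod_cast hℓ
  have hd : 4 * (ℓ : ℝ) ^ 2 - 1 ≠ 0 := by nlinarith
  have hℓne : (ℓ : ℝ) ^ 2 ≠ 0 := by positivity
  exact div_ne_zero (mul_ne_zero (neg_ne_zero.mpr h12) hℓne) hd

/-- **The value-level residue theorem** (Kos–Poland–Simmons-Duffin 2014 §4, family 3, `k = 1`, `d = 3`):
for `ℓ ≥ 1`, every `Δ₁₂, Δ₃₄` and every point of the open square,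
`(Δ - ℓ - 1) · g^{Δ₁₂,Δ₃₄}_{Δ,ℓ}(z,z̄) → blockResidueConst Δ₁₂ Δ₃₄ ℓ · g^{Δ₁₂,Δ₃₄}_{ℓ+2,ℓ-1}(z,z̄)` as
`Δ ↓ ℓ + 1`, where `g = hrBlockAB` is the typed block (sum of the Dolan–Osborn `z`-series). For
`Δ₁₂ Δ₃₄ = 0` the constant vanishes (no pole). [cite: KosPolandSimmonsduffin2014, §4 eqs. (4.2)–(4.3)] -/
theorem tendsto_sub_mul_hrBlockAB (Δ₁₂ Δ₃₄ : ℝ) {ℓ : ℕ} (hℓ : 1 ≤ ℓ) {z zb : ℝ}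
    (hz : z ∈ Ioo (0 : ℝ) 1) (hzb : zb ∈ Ioo (0 : ℝ) 1) :
    Tendsto (fun Δ : ℝ => (Δ - ℓ - 1) * hrBlockAB Δ₁₂ Δ₃₄ Δ ℓ z zb) (𝓝[>] ((ℓ : ℝ) + 1))
      (𝓝 (blockResidueConst Δ₁₂ Δ₃₄ ℓ * hrBlockAB Δ₁₂ Δ₃₄ ((ℓ : ℝ) + 2) (ℓ - 1) z zb)) := by
  have hzabs : |z| < 1 := by rw [abs_of_pos hz.1]; exact hz.2
  have hzbabs : |zb| < 1 := by rw [abs_of_pos hzb.1]; exact hzb.2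
  have hx : 0 < z * zb := mul_pos hz.1 hzb.1
  -- the prefactor
  have hpow : Tendsto (fun Δ : ℝ => (z * zb) ^ ((Δ - (ℓ : ℝ)) / 2)) (𝓝[>] ((ℓ : ℝ) + 1))
      (𝓝 ((z * zb) ^ ((((ℓ : ℝ) + 1) - (ℓ : ℝ)) / 2))) := by
    have hc : Continuous fun Δ : ℝ => (z * zb) ^ ((Δ - (ℓ : ℝ)) / 2) :=
      (Real.continuous_const_rpow hx.ne').comp ((continuous_id.sub continuous_const).div_const _)
    exact hc.continuousAt.tendsto.mono_left nhdsWithin_le_nhds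
  -- the series
  have hser : Tendsto (fun Δ : ℝ => (Δ - ℓ - 1) * hrSeriesAB (-Δ₁₂ / 2) (Δ₃₄ / 2) Δ ℓ z zb)
      (𝓝[>] ((ℓ : ℝ) + 1))
      (𝓝 (hrResidueConst (-Δ₁₂ / 2) (Δ₃₄ / 2) ℓ * (legendreLam (ℓ - 1) / legendreLam ℓ) * (z * zb) *
        hrSeriesAB (-Δ₁₂ / 2) (Δ₃₄ / 2) ((ℓ : ℝ) + 2) (ℓ - 1) z zb)) := by
    rw [← (hasSum_resCoeffAB (-Δ₁₂ / 2) (Δ₃₄ / 2) hℓ hzabs hzbabs).tsum_eq]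
    exact tendsto_sub_mul_hrSeriesAB _ _ hℓ hzabs hzbabs
  have hprod := hpow.mul hser
  have hfun : (fun Δ : ℝ => (Δ - ℓ - 1) * hrBlockAB Δ₁₂ Δ₃₄ Δ ℓ z zb) = fun Δ : ℝ =>
      (z * zb) ^ ((Δ - (ℓ : ℝ)) / 2) * ((Δ - ℓ - 1) * hrSeriesAB (-Δ₁₂ / 2) (Δ₃₄ / 2) Δ ℓ z zb) := by
    funext Δ; unfold hrBlockAB; ring
  rw [hfun]
  refine hprod.congr' (Eventually.of_forall fun _ => rfl) |>.mono_right (le_of_eq ?_)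
  congr 1
  -- `(z z̄)^{1/2} · (z z̄) = (z z̄)^{3/2} = (z z̄)^{((ℓ+2) - (ℓ-1))/2}`
  unfold hrBlockAB blockResidueConst
  have hcast : ((ℓ - 1 : ℕ) : ℝ) = (ℓ : ℝ) - 1 := by rw [Nat.cast_sub hℓ, Nat.cast_one]
  have he1 : (((ℓ : ℝ) + 1) - (ℓ : ℝ)) / 2 = (1 : ℝ) / 2 := by ring
  have he2 : (((ℓ : ℝ) + 2) - ((ℓ - 1 : ℕ) : ℝ)) / 2 = (1 : ℝ) / 2 + 1 := by rw [hcast]; ring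
  rw [he1, he2, Real.rpow_add hx, Real.rpow_one]
  ring

/-! ### 5. Non-existence of the typed block at the genuine pole -/

/-- The typed series `K^{ab}_{Δ,ℓ}` does not vanish identically on the open square (its boundary
coefficient `k_{ℓ,0}` is `1`; identity theorem for double power series). [folklore] -/
theorem exists_hrSeriesAB_ne_zero (a b : ℝ) {Δ : ℝ} {ℓ : ℕ} (hΔ : unitarityBound3D ℓ < Δ) :
    ∃ z zb : ℝ, z ∈ Ioo (0 : ℝ) 1 ∧ zb ∈ Ioo (0 : ℝ) 1 ∧ hrSeriesAB a b Δ ℓ z zb ≠ 0 := by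
  by_contra h
  have h0 : ∀ z zb : ℝ, z ∈ Ioo (0 : ℝ) 1 → zb ∈ Ioo (0 : ℝ) 1 → hrSeriesAB a b Δ ℓ z zb = 0 := by
    intro z zb hz hzb
    by_contra hne
    exact h ⟨z, zb, hz, hzb, hne⟩
  have hS := isDoublePowerSeriesOn_hrSeriesAB (a := a) (b := b) hΔ
  have hk : hrMonomialCoeffAB a b Δ ℓ = 0 := by
    refine eq_zero_of_double_tsum_eq_zero _ fun z zb hz0 hz1 hzb0 hzb1 => ⟨?_, ?_⟩
    · exact hS.summable hz0.le hz1 hzb0.le hzb1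
    · have h' := h0 z zb ⟨hz0, hz1⟩ ⟨hzb0, hzb1⟩
      unfold hrSeriesAB at h'
      exact h'
  have h1 := (hrMonomialCoeffAB_hasLeadingPart a b Δ ℓ).2
  rw [hk] at h1
  simp at h1

/-- The typed block `hrBlockAB` does not vanish identically on the open square. [folklore] -/
theorem exists_hrBlockAB_ne_zero (Δ₁₂ Δ₃₄ : ℝ) {Δ : ℝ} {ℓ : ℕ} (hΔ : unitarityBound3D ℓ < Δ) :
    ∃ z zb : ℝ, z ∈ Ioo (0 : ℝ) 1 ∧ zb ∈ Ioo (0 : ℝ) 1 ∧ hrBlockAB Δ₁₂ Δ₃₄ Δ ℓ z zb ≠ 0 := by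
  obtain ⟨z, zb, hz, hzb, hne⟩ := exists_hrSeriesAB_ne_zero (-Δ₁₂ / 2) (Δ₃₄ / 2) hΔ
  refine ⟨z, zb, hz, hzb, ?_⟩
  unfold hrBlockAB
  exact mul_ne_zero (Real.rpow_pos_of_pos (mul_pos hz.1 hzb.1) _).ne' hne

/-- **No block at the genuine pole.** For `Δ₁₂ Δ₃₄ ≠ 0` and `ℓ ≥ 1` no function satisfies the typed
predicate `IsConformalBlock3D Δ₁₂ Δ₃₄ (ℓ+1) ℓ`: the point is the unitarity bound (not regular), and the
limit clause fails because the generic blocks `g_{Δ',ℓ} = hrBlockAB` (uniqueness at the regular points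
`Δ' ↓ ℓ+1`) have `(Δ' - ℓ - 1) g_{Δ',ℓ} → blockResidueConst · g_{ℓ+2,ℓ-1} ≠ 0` somewhere on the square,
so `g_{Δ',ℓ}` itself has no finite pointwise limit there (Kos–Poland–Simmons-Duffin 2014 §4: "when the
residue does not vanish there is no limit"). [cite: KosPolandSimmonsduffin2014, §4 eqs. (4.2)–(4.3)] -/
theorem not_isConformalBlock3D_of_pole {Δ₁₂ Δ₃₄ : ℝ} (h12 : Δ₁₂ * Δ₃₄ ≠ 0) {ℓ : ℕ} (hℓ : 1 ≤ ℓ)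
    (g : ℝ → ℝ → ℝ) : ¬ IsConformalBlock3D Δ₁₂ Δ₃₄ ((ℓ : ℝ) + 1) ℓ g := by
  have hb : unitarityBound3D ℓ = (ℓ : ℝ) + 1 := unitarityBound3D_eq_of_one_le hℓ
  rintro (⟨hreg, -⟩ | ⟨-, G, hG, hlim⟩)
  · exact hreg.1 hb.symm
  · obtain ⟨z, zb, hz, hzb, hne⟩ :=
      exists_hrBlockAB_ne_zero Δ₁₂ Δ₃₄ (ℓ := ℓ - 1) (Δ := (ℓ : ℝ) + 2) (unitarityBound3D_pred_lt ℓ)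
    -- eventually `G Δ' = hrBlockAB` at `(z, z̄)` (regular points, uniqueness)
    have hev : ∀ᶠ Δ in 𝓝[>] ((ℓ : ℝ) + 1), G Δ z zb = hrBlockAB Δ₁₂ Δ₃₄ Δ ℓ z zb := by
      have h1 := eventually_isRegularPoint3D_nhdsGT_of_bound_le (le_of_eq hb)
      have h2 : ∀ᶠ Δ in 𝓝[>] ((ℓ : ℝ) + 1), Δ ∈ Ioo ((ℓ : ℝ) + 1) ((ℓ : ℝ) + 1 + 1) :=
        Ioo_mem_nhdsGT (by linarith)
      filter_upwards [h1, h2] with Δ hreg hΔ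
      have hlt : unitarityBound3D ℓ < Δ := by rw [hb]; exact hΔ.1
      exact (hG Δ hΔ).eq_hrBlockAB hlt hreg.2 z zb hz hzb
    -- `(Δ-ℓ-1) G Δ z z̄ → 0`
    have hA : Tendsto (fun Δ : ℝ => (Δ - ℓ - 1) * G Δ z zb) (𝓝[>] ((ℓ : ℝ) + 1)) (𝓝 0) := by
      have hc : Tendsto (fun Δ : ℝ => Δ - ℓ - 1) (𝓝[>] ((ℓ : ℝ) + 1)) (𝓝 0) := by
        have hcont : Continuous (fun Δ : ℝ => Δ - ℓ - 1) := by fun_prop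
        exact (hcont.tendsto' ((ℓ : ℝ) + 1) 0 (by simp)).mono_left nhdsWithin_le_nhds
      simpa using hc.mul (hlim z zb hz hzb)
    -- `(Δ-ℓ-1) G Δ z z̄ → blockResidueConst · g_{ℓ+2,ℓ-1}(z,z̄) ≠ 0`
    have hB : Tendsto (fun Δ : ℝ => (Δ - ℓ - 1) * G Δ z zb) (𝓝[>] ((ℓ : ℝ) + 1))
        (𝓝 (blockResidueConst Δ₁₂ Δ₃₄ ℓ * hrBlockAB Δ₁₂ Δ₃₄ ((ℓ : ℝ) + 2) (ℓ - 1) z zb)) :=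
      (tendsto_sub_mul_hrBlockAB Δ₁₂ Δ₃₄ hℓ hz hzb).congr'
        (by filter_upwards [hev] with Δ h; rw [h])
    have huniq := tendsto_nhds_unique hA hB
    exact mul_ne_zero (blockResidueConst_ne_zero h12 hℓ) hne huniq.symm

/-- **Satisfiability of the typed predicate in the pole family, both directions**: for `Δ₁₂ Δ₃₄ ≠ 0`,
`ℓ ≥ 1` and `Δ₀ ≥ ℓ + 1` (the unitarity bound), `IsConformalBlock3D Δ₁₂ Δ₃₄ Δ₀ ℓ` has a solution iff
`Δ₀ ≠ ℓ + 1` (existence above the bound: `BlockExistenceLimitAB`).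
[cite: KosPolandSimmonsduffin2014, §4 eqs. (4.2)–(4.3)] -/
theorem exists_isConformalBlock3D_iff_ne_bound {Δ₁₂ Δ₃₄ : ℝ} (h12 : Δ₁₂ * Δ₃₄ ≠ 0) {ℓ : ℕ}
    (hℓ : 1 ≤ ℓ) {Δ₀ : ℝ} (hΔ₀ : (ℓ : ℝ) + 1 ≤ Δ₀) :
    (∃ g : ℝ → ℝ → ℝ, IsConformalBlock3D Δ₁₂ Δ₃₄ Δ₀ ℓ g) ↔ Δ₀ ≠ (ℓ : ℝ) + 1 := by
  constructor
  · rintro ⟨g, hg⟩ h0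
    rw [h0] at hg
    exact not_isConformalBlock3D_of_pole h12 hℓ g hg
  · intro hne
    have hlt : unitarityBound3D ℓ < Δ₀ := by
      rw [unitarityBound3D_eq_of_one_le hℓ]
      exact lt_of_le_of_ne hΔ₀ (Ne.symm hne)
    exact exists_isConformalBlock3D_of_lt Δ₁₂ Δ₃₄ hlt

/-! ### 6. Consequence for the typed `σ–ε` data: no odd-sector conserved currents -/

namespace SigmaEpsilonData

/-- **Clause A2 excludes spin-`ℓ ≥ 1` operators of `σ × ε` at the unitarity bound** when `Δ_σ ≠ Δ_ε`:
the `⟨εσσε⟩` block family `gpm` (`Δ₁₂ = -Δ_σε`, `Δ₃₄ = Δ_σε`, so `Δ₁₂ Δ₃₄ = -Δ_σε² ≠ 0`) has no typed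
block at `Δ = ℓ + 1`. [cite: KosPolandSimmonsduffin2014, §4 eqs. (4.2)–(4.3)] -/
theorem Δm_ne_bound_of_hasGenuineBlocks (D : SigmaEpsilonData) (hD : D.HasGenuineBlocks)
    (hne : D.Δσ ≠ D.Δε) (j : D.ιm) (hℓ : 1 ≤ D.ℓm j) : D.Δm j ≠ (D.ℓm j : ℝ) + 1 := by
  intro h
  have hg := hD.2.2 j
  rw [h] at hg
  have hs : D.Δσε ≠ 0 := sub_ne_zero.mpr hne
  exact not_isConformalBlock3D_of_pole (mul_ne_zero (neg_ne_zero.mpr hs) hs) hℓ (D.gpm j) hg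

/-- With the unitarity clause: under the typed bootstrap axioms with `Δ_σ ≠ Δ_ε`, every `ℤ₂`-odd
exchanged operator of spin `ℓ ≥ 1` lies STRICTLY above the unitarity bound, `Δ > ℓ + 1` — as the Ward
identity forces in a CFT (a conserved current cannot couple to two scalars of different dimension).
[cite: KosPolandSimmonsduffin2014, §4 eqs. (4.2)–(4.3)] -/
theorem bound_lt_Δm_of_satisfiesBootstrapAxioms (D : SigmaEpsilonData)
    (hD : D.SatisfiesBootstrapAxioms) (hne : D.Δσ ≠ D.Δε) (j : D.ιm) (hℓ : 1 ≤ D.ℓm j) :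
    (D.ℓm j : ℝ) + 1 < D.Δm j := by
  have hu : unitarityBound3D (D.ℓm j) ≤ D.Δm j := hD.2.1.2.2.2.2 j
  rw [unitarityBound3D_eq_of_one_le hℓ] at hu
  exact lt_of_le_of_ne hu (Ne.symm (Δm_ne_bound_of_hasGenuineBlocks D hD.1 hne j hℓ))

end SigmaEpsilonData

end Literature.MathematicalPhysics.QuantumFieldTheory.ConformalBootstrap3D
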